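import Mathlib
import Literature.Analysis.FluidPDE.Tao2016AveragedNS.ShiftSetCascadeFlows
import Summits.NavierStokesRegularity.NavierStokesRegularity.Theorems.TaoLadderRungTwoFlatCertificateGlueBranchMeshOn
import Summits.NavierStokesRegularity.NavierStokesRegularity.Theorems.TaoLadderRungTwoFlatCertificateGluePicardStepOn
import Summits.NavierStokesRegularity.NavierStokesRegularity.Theorems.TaoLadderRungTwoFlatCertificateGlueLohnerCascadePerCompOn
import Summits.NavierStokesRegularity.NavierStokesRegularity.Theorems.TaoLadderRungTwoFlatCertificateGlueSectionNodeOn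
import HarnessLib

/-!
# Certificate glue on a shift set `𝕊`, XXXI: READOUT ALONG TRAJECTORIES — the readout step certificate `StepRead`, the branch landing clause
  from per-step TRAJECTORY readouts (`hland_of_branchMeshes'`), and its discharge by the section node of glue XXX
  (helper for items stmt-NavierStokesRegularity-22987 `FlatGapCertificatesV2` (crux K_A♭ of route TaoLadderRungTwoFlat) and stmt-24295 K_A₂(64);
  cell harvest/h2-tao-ladder, p1 g15; theory-1 g25 F-28: a fixed-time readout on hulls cannot close the matching clause, the readout must be taken
  at each trajectory's own crossing — E3 v0.2 REPORT §3)

`StepRead … t Node P j`: every window run of length `0 < s ≤ t (j+1) − t j` from `Node j` (in the closed `M`-box) ENDS in a `P`-state.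
`read_of_mesh'` / `hland_of_branchMeshes'`: glue XXII with the static hull readout `∀ y ∈ Hull j, P y` replaced by `StepRead … P j` on the
readout steps `j₁ ≤ j ≤ j₂` (same conclusion: the clause `hland` of glue IV verbatim). `stepRead_of_sectionNode`: a certified step whose node is
a parallelepiped `PInPara x̄ C r E₀`, whose hull lies in a box `[lo, hi]` with field range `[dlo, dhi]` (glue `FieldRangeOn`), and section data
`q, p, f` with `d > 0` ⇒ `StepRead` for `P y := (sec_q (pxcoord y) = lev → pxcoord y ∈ box hull of the section node)` (glue XXX
`sectionNode_box`, the flow increment boxed by `picard_level`).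

HONEST FRAMING: Tao-type MODEL lattices (Tao 2016 §4/§6 vocabulary, shift-set parametrised); glue lemmas for a checker — NO certificate
instance exists in the tree, nothing is certified here, no stub is closed, nothing here is a statement about the Navier–Stokes equations.
-/

-- the sub-problem namespace repeats the summit name by design (D-0017)
set_option linter.dupNamespace false

namespace Summit.NavierStokesRegularity.NavierStokesRegularity.Theorems

open Set Filter Topology Literature.Analysis.FluidPDE Literature.Analysis.FluidPDE.TaoCascade

namespace CertificateGlueOn

variable {m : ℕ} {𝕊 : Finset (ℤ × ℤ × ℤ)} {ε₀ : ℝ} {α : Fin m → Fin m → Fin m → ℤ × ℤ × ℤ → ℝ} {Kb Ka : ℤ}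
  {Eb Et : ℝ} {M : ℤ → ℝ}

/-- **READOUT STEP CERTIFICATE**: every window run of length `0 < s ≤ t (j+1) − t j` from `Node j`, a priori in the closed `M`-box, ends in
a `P`-state. [cite: Tao2016AveragedNS, §6.3–6.4 Props. 6.4–6.5 (statement shape; the readout at the crossing); cell certificate format, readout step] -/
def StepRead (𝕊 : Finset (ℤ × ℤ × ℤ)) (ε₀ : ℝ) (α : Fin m → Fin m → Fin m → ℤ × ℤ × ℤ → ℝ) (Kb Ka : ℤ) (Eb Et : ℝ)
    (M : ℤ → ℝ) (t : ℕ → ℝ) (Node : ℕ → (Fin m → ℤ → ℝ) → Prop) (P : (Fin m → ℤ → ℝ) → Prop) (j : ℕ) : Prop :=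
  ∀ (s : ℝ) (S : Fin m → ℤ → ℝ → ℝ), 0 < s → s ≤ t (j + 1) - t j → Node j (slice S 0) →
    WindowRun 𝕊 ε₀ α Kb Ka Eb Et s S → (∀ i k, -Kb ≤ k → k ≤ Ka → ∀ u ∈ Icc 0 s, |S i k u| ≤ M k) → P (slice S s)

section OneBranch

variable {t : ℕ → ℝ} {Node Hull : ℕ → (Fin m → ℤ → ℝ) → Prop} {Box : (Fin m → ℤ → ℝ) → Prop}

/-- **Readout along trajectories from a mesh** (glue XXII `read_of_mesh` with the static hull readout replaced by `StepRead`): steps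
`0 … j₂` certified, `P` on `Node j₁`, `StepRead P j` for `j₁ ≤ j ≤ j₂` ⇒ every run of length `s ∈ [t j₁, t (j₂+1)]` from `Box` ends in a
`P`-state. [cite: Tao2016AveragedNS, §6.3–6.4 Props. 6.4–6.5 (statement shape; the readout at the crossing); cell certificate format, branch layer from mesh layer] -/
theorem read_of_mesh' {P : (Fin m → ℤ → ℝ) → Prop} {j₁ j₂ : ℕ} (hj : j₁ ≤ j₂) (ht0 : t 0 = 0)
    (hmono : ∀ j, j < j₂ + 1 → t j < t (j + 1)) (hpos : 0 < t j₁) (hbox : ∀ y, Box y → Node 0 y)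
    (hstep : ∀ j, j < j₂ + 1 → StepCert 𝕊 ε₀ α Kb Ka Eb Et M t Node Hull j)
    (hP₁ : ∀ y, Node j₁ y → P y) (hP : ∀ j, j₁ ≤ j → j ≤ j₂ → StepRead 𝕊 ε₀ α Kb Ka Eb Et M t Node P j) :
    ∀ (s : ℝ) (S : Fin m → ℤ → ℝ → ℝ), t j₁ ≤ s → s ≤ t (j₂ + 1) → Box (slice S 0) →
      WindowRun 𝕊 ε₀ α Kb Ka Eb Et s S → (∀ i k, -Kb ≤ k → k ≤ Ka → ∀ u ∈ Icc 0 s, |S i k u| ≤ M k) →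
        P (slice S s) := by
  intro s S hs1 hs2 hb hrun hM
  have hs : 0 < s := hpos.trans_le hs1
  have htmono : ∀ j j', j ≤ j' → j' ≤ j₂ + 1 → t j ≤ t j' := by
    intro j j' hjj' hj'
    induction j' with
    | zero => rw [Nat.le_zero.mp hjj']
    | succ j' ih =>
      rcases Nat.lt_or_ge j (j' + 1) with h | h
      · exact (ih (by omega) (by omega)).trans (hmono j' (by omega)).le
      · rw [le_antisymm hjj' h]
  rcases hs1.eq_or_lt with hs1' | hs1'
  · -- `s = t j₁`: the state is the node `j₁`
    rw [← hs1']
    rw [← hs1'] at hrun hM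
    exact hP₁ _ (node_of_mesh ht0 hmono hstep hrun (hbox _ hb) hM j₁ (by omega) le_rfl)
  -- the step `j ∈ [j₁, j₂]` containing `s > t j₁`: the first index with `s ≤ t (j+1)`
  classical
  have hex : ∃ j, s ≤ t (j + 1) := ⟨j₂, hs2⟩
  set j := Nat.find hex with hjdef
  have hju : s ≤ t (j + 1) := Nat.find_spec hex
  have hj2 : j ≤ j₂ := Nat.find_min' hex hs2
  have htj : t j < s := by
    rcases Nat.eq_zero_or_pos j with h | h
    · rw [h, ht0]; exact hs
    · have hmin := Nat.find_min hex (show j - 1 < j by omega)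
      rw [Nat.sub_add_cancel h] at hmin
      push Not at hmin
      exact hmin
  have hj1 : j₁ ≤ j := by
    by_contra h
    push Not at h
    have : t (j + 1) ≤ t j₁ := htmono (j + 1) j₁ (by omega) (by omega)
    linarith
  -- restart the run at the node `t j` and read at the end
  have hj0 : 0 ≤ t j := by have := htmono 0 j (Nat.zero_le _) (by omega); rwa [ht0] at this
  have hnode := node_of_mesh ht0 hmono hstep hrun (hbox _ hb) hM j (by omega) htj.le
  have hrun' : WindowRun 𝕊 ε₀ α Kb Ka Eb Et (s - t j) (fun i k u => S i k (t j + u)) := hrun.shift hj0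
  have e1 : slice (fun i k u => S i k (t j + u)) 0 = slice S (t j) := by rw [slice_shift, add_zero]
  have e2 : slice (fun i k u => S i k (t j + u)) (s - t j) = slice S s := by rw [slice_shift, add_sub_cancel]
  have h := hP j hj1 hj2 (s - t j) _ (by linarith) (by linarith) (by rw [e1]; exact hnode) hrun'
    (fun i k hk1 hk2 v hv => hM i k hk1 hk2 (t j + v) ⟨by linarith [hv.1], by linarith [hv.2]⟩)
  rwa [e2] at h

end OneBranch

/-! ### A family of branches: the landing clause from trajectory readouts -/

section Branches

variable {ι : Type*} {Core : (Fin m → ℤ → ℝ) → Prop} {w : ℤ → ℝ} {r : ℝ}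
  {Box : ι → (Fin m → ℤ → ℝ) → Prop} {t : ι → ℕ → ℝ}
  {Node Hull : ι → ℕ → (Fin m → ℤ → ℝ) → Prop}

/-- **THE LANDING CLAUSE `hland` FROM PER-BRANCH MESH CERTIFICATES WITH TRAJECTORY READOUTS**: glue XXII `hland_of_branchMeshes` with the
static readout on hull states replaced by `StepRead` on the readout steps `j₁ b ≤ j ≤ j₂ b` (the readout is taken at each trajectory's own
crossing of the section `{sec = lev}`). [cite: Tao2016AveragedNS, §6.3–6.4 Props. 6.4–6.5 (statement shape of a renormalisation certificate; the readout at the crossing); cell certificate format, branch layer from mesh layer] -/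
theorem hland_of_branchMeshes' {ρ θ₀ σ c₀ Zx : ℝ} {i₀ : Fin m} {sec : (Fin m → ℤ → ℝ) → ℝ} {lev : ℝ}
    {j₁ j₂ : ι → ℕ}
    (hcover : ∀ (z S₀ : Fin m → ℤ → ℝ), Core z →
      (∀ i k, -Kb ≤ k → k ≤ Ka → w k * |S₀ i k - z i k| ≤ r) → ∃ b, Box b S₀)
    (hj : ∀ b, j₁ b ≤ j₂ b) (ht0 : ∀ b, t b 0 = 0) (hmono : ∀ b j, j < j₂ b + 1 → t b j < t b (j + 1))
    (hpos : ∀ b, 0 < t b (j₁ b)) (hc₀ : ∀ b, t b (j₂ b + 1) ≤ c₀) (hbox : ∀ b y, Box b y → Node b 0 y)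
    (hstep : ∀ b j, j < j₂ b + 1 → StepCert 𝕊 ε₀ α Kb Ka Eb Et M (t b) (Node b) (Hull b) j)
    (hsec : ∀ (s : ℝ) (S : Fin m → ℤ → ℝ → ℝ), WindowRun 𝕊 ε₀ α Kb Ka Eb Et s S →
      ContinuousOn (fun u => sec (slice S u)) (Icc 0 s))
    (hbefore : ∀ b y, Node b (j₁ b) y → sec y < lev) (hafter : ∀ b y, Node b (j₂ b + 1) y → lev ≤ sec y)
    (hread : ∀ b j, j₁ b ≤ j → j ≤ j₂ b → StepRead 𝕊 ε₀ α Kb Ka Eb Et M (t b) (Node b) (fun y => sec y = lev →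
      ∃ (a : ℝ) (z' : Fin m → ℤ → ℝ), 0 < a ∧ (1 + ε₀) ^ (-θ₀) ≤ a ∧ (1 + σ) * a ≤ |y i₀ 1| ∧ Core z' ∧
        (∀ i k, -Kb ≤ k → k + 1 ≤ Ka → w k * |y i (1 + k) / a - z' i k| ≤ ρ * r) ∧
        (∀ (i : Fin m) (v : ℝ), |v| ≤ Et → w Ka * |v / a - z' i Ka| ≤ ρ * r) ∧
        (∀ i, |y i (-Kb)| ≤ a * Zx)) j) :
    ∀ (z : Fin m → ℤ → ℝ) (S : Fin m → ℤ → ℝ → ℝ), Core z →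
      (∀ i k, -Kb ≤ k → k ≤ Ka → w k * |S i k 0 - z i k| ≤ r) →
      (∀ i k, -Kb ≤ k → k ≤ Ka → ∀ u ∈ Icc 0 c₀,
        HasDerivWithinAt (S i k) (quadTermOn 𝕊 ε₀ α S i k u) (Icc 0 c₀) u) →
      (∀ i, ContinuousOn (S i (-Kb - 1)) (Icc 0 c₀)) → (∀ i, ContinuousOn (S i (Ka + 1)) (Icc 0 c₀)) →
      (∀ i, ∀ u ∈ Icc 0 c₀, |S i (-Kb - 1) u| ≤ Eb) →
      (∀ i, ∀ u ∈ Icc 0 c₀, |S i (Ka + 1) u| ≤ Et) →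
      (∀ i k, -Kb ≤ k → k ≤ Ka → ∀ u ∈ Icc 0 c₀, |S i k u| ≤ M k) →
        ∃ (τ₁ a : ℝ) (z' : Fin m → ℤ → ℝ), 0 < τ₁ ∧ τ₁ ≤ c₀ ∧ 0 < a ∧ (1 + ε₀) ^ (-θ₀) ≤ a ∧
          (1 + σ) * a ≤ |S i₀ 1 τ₁| ∧ Core z' ∧
          (∀ i k, -Kb ≤ k → k + 1 ≤ Ka → w k * |S i (1 + k) τ₁ / a - z' i k| ≤ ρ * r) ∧
          (∀ (i : Fin m) (v : ℝ), |v| ≤ Et → w Ka * |v / a - z' i Ka| ≤ ρ * r) ∧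
          (∀ i, |S i (-Kb) τ₁| ≤ a * Zx) := by
  have htmono : ∀ b j j', j ≤ j' → j' ≤ j₂ b + 1 → t b j ≤ t b j' := by
    intro b j j' hjj' hj'
    induction j' with
    | zero => rw [Nat.le_zero.mp hjj']
    | succ j' ih =>
      rcases Nat.lt_or_ge j (j' + 1) with h | h
      · exact (ih (by omega) (by omega)).trans (hmono b j' (by omega)).le
      · rw [le_antisymm hjj' h]
  refine hland_of_branches (tlo := fun b => t b (j₁ b)) (thi := fun b => t b (j₂ b + 1)) hcover
    (fun b => ⟨hpos b, htmono b _ _ (by have := hj b; omega) le_rfl, hc₀ b⟩) hsec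
    (fun b => sec_lt_of_mesh (ht0 b) (fun j hj' => hmono b j (by have := hj b; omega)) (hbox b)
      (fun j hj' => hstep b j (by have := hj b; omega)) (hbefore b))
    (fun b => le_sec_of_mesh (ht0 b) (hmono b) (hbox b) (hstep b) (hafter b))
    (fun b s S hs1 hs2 hb hrun hM => ?_)
  exact read_of_mesh' (P := fun y => sec y = lev → _) (hj b) (ht0 b) (hmono b) (hpos b) (hbox b) (hstep b)
    (fun y hy hlev => absurd hlev (hbefore b y hy).ne) (fun j hj1' hj2' => hread b j hj1' hj2')
    s S hs1 hs2 hb hrun hM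

end Branches

/-! ### Discharging `StepRead` by the section node -/

/-- **`StepRead` FROM THE SECTION NODE**: a certified step with parallelepiped node `PInPara x̄ C r E₀`, hull inside the box `[lo, hi]` with field
range `[dlo, dhi]`, step length `≤ Δ`, and section data `q, p, f` (`d > 0`, `κ ≥ |f|/d`, `Φ ≥` the field spread about `f` in weighted
coordinates, `W ≥` the box extent about `p`) ⇒ every run from the node read at a time where `sec_q = lev` lies in the box hull of the section
node of glue XXX. [cite: Zgliczynski2002C1Lohner, §3–4 (Lohner-type parallelepiped sets; section maps); cell certificate format, section readout] -/
theorem stepRead_of_sectionNode (hKb : 0 ≤ Kb) (hKa : 1 ≤ Ka) {ω : Fin m → ℤ → ℝ} (hω : ∀ i k, 0 < ω i k)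
    {t : ℕ → ℝ} {Node Hull : ℕ → (Fin m → ℤ → ℝ) → Prop} {j : ℕ}
    {xb r : Fin (m * winLen Kb Ka) → ℝ} {C : Matrix (Fin (m * winLen Kb Ka)) (Fin (m * winLen Kb Ka)) ℝ} {E₀ : ℝ}
    {lo hi dlo dhi : Fin m → ℤ → ℝ} {q p f κ Φ W : Fin (m * winLen Kb Ka) → ℝ} {Δ lev : ℝ}
    (hstep : StepCert 𝕊 ε₀ α Kb Ka Eb Et M t Node Hull j)
    (hN : ∀ y, Node j y → PInPara Kb Ka ω xb C r E₀ y) (hHB : ∀ y, Hull j y → InBoxOn Kb Ka lo hi y)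
    (hrange : FieldRangeOn 𝕊 ε₀ α Kb Ka Eb Et lo hi dlo dhi) (hΔ : t (j + 1) - t j ≤ Δ)
    (hd : 0 < secD q p f) (hκ : ∀ c, |f c| ≤ κ c * secD q p f)
    (hF : ∀ c, pxcoord Kb Ka ω dlo c ≤ pxcoord Kb Ka ω dhi c)
    (hΦ : ∀ c, pxcoord Kb Ka ω dhi c - f c ≤ Φ c ∧ f c - pxcoord Kb Ka ω dlo c ≤ Φ c)
    (hW : ∀ y, InBoxOn Kb Ka lo hi y → ∀ c, |pxcoord Kb Ka ω y c - p c| ≤ W c) :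
    StepRead 𝕊 ε₀ α Kb Ka Eb Et M t Node (fun y => secQ q (pxcoord Kb Ka ω y) = lev →
      ∀ c, |pxcoord Kb Ka ω y c - secCentre q p f xb lev c| ≤
        ∑ col, |secFrame q p f C c col| * r col + secErr q p κ (fun _ => E₀) Φ Δ (secQmax q W) c) j := by
  intro s S hs0 hs1 hnode hrun hM hsec c
  have hKK : 0 ≤ Ka + Kb + 1 := by omega
  -- the run stays in the hull, hence in the box
  have hin : ∀ u ∈ Icc 0 s, InBoxOn Kb Ka lo hi (slice S u) :=
    fun u hu => hHB _ ((hstep s S hs0 hs1 hnode hrun hM).1 u hu)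
  -- the flow increment is boxed (mean value, glue `picard_level`)
  have hpl := picard_level hrun hrange hin
  obtain ⟨ξ, e, hξ, he, hx0⟩ := hN _ hnode
  have hδ : ∀ d, s * pxcoord Kb Ka ω dlo d ≤ pxcoord Kb Ka ω (slice S s) d - pxcoord Kb Ka ω (slice S 0) d ∧
      pxcoord Kb Ka ω (slice S s) d - pxcoord Kb Ka ω (slice S 0) d ≤ s * pxcoord Kb Ka ω dhi d := by
    intro d
    obtain ⟨hk1, hk2⟩ := shellAt_mem hKK (finProdFinEquiv.symm d).2
    have h := hpl (finProdFinEquiv.symm d).1 (shellAt Kb (finProdFinEquiv.symm d).2) hk1 hk2 s ⟨hs0.le, le_rfl⟩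
    have hωp := hω (finProdFinEquiv.symm d).1 (shellAt Kb (finProdFinEquiv.symm d).2)
    simp only [pxcoord, pwcoord, slice_apply]
    rw [← sub_div, mul_div_assoc', mul_div_assoc']
    exact ⟨div_le_div_of_nonneg_right h.1 hωp.le, div_le_div_of_nonneg_right h.2 hωp.le⟩
  exact sectionNode_box (E := fun _ => E₀) hd hκ hx0 hξ he ⟨hs0.le, hs1.trans hΔ⟩ hδ hF hΦ hsec
    (hW _ (hin s ⟨hs0.le, le_rfl⟩)) c

end CertificateGlueOn

end Summit.NavierStokesRegularity.NavierStokesRegularity.Theorems
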